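import Literature.NumberTheory.LFunctions.ZetaArgVariation
import Literature.Analysis.SpecialFunctions.DigammaStirlingSecondOrder
import HarnessLib

/-!
# Reflection of `arg (s-1)ζ(s)` in the critical line: the error term of Backlund's trick

Topic `Literature/NumberTheory/LFunctions`.  Everything in this file is PROVED; there are no named
facts and no definitions.

Backlund's trick (`Literature/Analysis/Complex/BacklundTrick.lean`,
`Literature.Analysis.Complex.abs_im_integral_logDeriv_le_backlundTrick`) halves Backlund's bound
for the variation of `arg g` along `[x₀, σ₁] × {T}` when
`|Im ∫_{x₀}^{x₀+d} g'/g + Im ∫_{x₀}^{x₀-d} g'/g| ≤ ε` for `0 ≤ d ≤ δ`.  For `g = ζ₁ = (s-1)ζ(s)`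
and `x₀ = ½` this is the functional equation: `ξ'/ξ(1 - s̄) = -conj ξ'/ξ(s)` makes the `ξ`-part of
`ζ₁'/ζ₁ = ξ'/ξ - 1/s - Γℝ'/Γℝ` cancel exactly, and what remains is the variation across the
critical line of `arg s` and of `arg Γℝ(s) = -½ t log π + Im log Γ(s/2)` — the quantity
`𝓔(T,d)` of Bennett–Martin–O'Bryant–Rechnitzer (Def. 3.3, Lemma 5.3) and Hasanalizade–Shen–Wong
(§2, `E(T,δ)`), which those papers bound for all `T ≥ 5/7` by `E(T,δ) ≤ π/1024 + O(1/T)` plus `π/2`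
for the arctangents.  Here, for the large `T` relevant to `S(T)`, Stirling's formula for `Im ψ`
(`Literature.Analysis.SpecialFunctions.Complex.abs_im_digamma_sub_arg_add_im_le`,
`DigammaStirlingSecondOrder.lean`) gives the true size `O(d²/T)`:

* `ZetaBacklundReflection.im_logDeriv_riemannZeta₁_eq` —
  `Im ζ₁'/ζ₁(x+iT) = Im ξ'/ξ(x+iT) + T/(x²+T²) - ½ Im ψ((x+iT)/2)` (`x, T > 0`, `ζ(x+iT) ≠ 0`);
* `ZetaBacklundReflection.abs_im_logDeriv_riemannZeta₁_sub_reflect_le` — for `½ ≤ x < 1`: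
  `|Im ζ₁'/ζ₁(x+iT) - Im ζ₁'/ζ₁((1-x)+iT)| ≤ (2x-1)(1/(2T) + 1/(2T³)) + 4/(3T³) + π/(3T²)`;
* `ZetaBacklundReflection.abs_im_integral_logDeriv_riemannZeta₁_reflect_le` — **for `T ≥ 4` not an
  ordinate of a zero of `ζ` and `0 ≤ d ≤ 3/8`,
  `|Im ∫_{1/2}^{1/2+d} ζ₁'/ζ₁(x+iT) dx + Im ∫_{1/2}^{1/2-d} ζ₁'/ζ₁(x+iT) dx| ≤ 1/T`** — the
  hypothesis `hrefl` of Backlund's trick for `ζ₁` with `ε = 1/T` (against `E/2 + π/4 ≈ 0.787` in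
  [HSW22, Prop. 3.2], a saving of `0.25` in the constant `C₃'` of their Theorem 1.3).

Auxiliary: `lipschitzWith_one_arctan`, `abs_im_digamma_half_sub_le`
(`Im ψ((x+iT)/2) = π/2 - arctan(x/T) + T/(x²+T²) + O(1/T²)`),
`continuous_logDeriv_riemannZeta₁_horizontal`.

## References

* M. A. Bennett, G. Martin, K. O'Bryant, A. Rechnitzer, *Counting zeros of Dirichlet
  `L`-functions*, Math. Comp. 90 (2021), 1455–1482 = arXiv:2005.02989, Def. 3.3, Lemma 5.3.
* E. Hasanalizade, Q. Shen, P.-J. Wong, *Counting zeros of the Riemann zeta function*, J. Number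
  Theory 235 (2022), 219–241, §2 (`E(T,δ)`, Lemma 2.1) and Prop. 3.2.
  [cite: HasanalizadeShenWong2022, Prop. 3.2]
* E. C. Titchmarsh, *The Theory of the Riemann Zeta-Function*, 2nd ed. (1986), §2.12, §9.4.
  [cite: Titchmarsh1986, §2.12]
-/

noncomputable section

open Complex Set MeasureTheory Filter Topology intervalIntegral Metric Real
open scoped Real ComplexConjugate

namespace Literature.NumberTheory.LFunctions

namespace ZetaBacklundReflection

/-- `arctan` is `1`-Lipschitz (`|arctan'| = 1/(1+x²) ≤ 1`). [folklore] -/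
theorem lipschitzWith_one_arctan : LipschitzWith 1 Real.arctan := by
  refine lipschitzWith_of_nnnorm_deriv_le Real.differentiable_arctan fun x ↦ ?_
  rw [Real.deriv_arctan]
  have h1 : 0 ≤ 1 / (1 + x ^ 2) := by positivity
  have h2 : 1 / (1 + x ^ 2) ≤ 1 := by
    rw [div_le_one (by positivity)]; nlinarith
  rw [← NNReal.coe_le_coe, coe_nnnorm, Real.norm_eq_abs, abs_of_nonneg h1]
  simpa using h2

/-- `Im (1/(x + iT)) = -T/(x² + T²)`. [folklore] -/
theorem im_inv_ofReal_add_mul_I (x T : ℝ) :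
    ((x : ℂ) + T * I)⁻¹.im = -T / (x ^ 2 + T ^ 2) := by
  rw [Complex.inv_im]
  simp [Complex.normSq_apply, pow_two]

/-- The difference of `T/(x²+T²)` at `x` and `1 - x`: `≤ (2x-1)/T³` for `½ ≤ x`, `T > 0`.
[folklore] -/
theorem abs_sub_kernel_le {x T : ℝ} (hx : 1 / 2 ≤ x) (hT : 0 < T) :
    |T / (x ^ 2 + T ^ 2) - T / ((1 - x) ^ 2 + T ^ 2)| ≤ (2 * x - 1) / T ^ 3 := by
  have h1 : 0 < x ^ 2 + T ^ 2 := by positivity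
  have h2 : 0 < (1 - x) ^ 2 + T ^ 2 := by positivity
  have e : T / (x ^ 2 + T ^ 2) - T / ((1 - x) ^ 2 + T ^ 2) =
      -(T * (2 * x - 1)) / ((x ^ 2 + T ^ 2) * ((1 - x) ^ 2 + T ^ 2)) := by
    field_simp
    ring
  rw [e, abs_div, abs_neg, abs_of_nonneg (by nlinarith), abs_of_pos (mul_pos h1 h2),
    div_le_div_iff₀ (mul_pos h1 h2) (by positivity)]
  have h3 : T ^ 3 * T ≤ (x ^ 2 + T ^ 2) * ((1 - x) ^ 2 + T ^ 2) := by nlinarith [sq_nonneg x, sq_nonneg (1 - x), sq_nonneg T]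
  calc T * (2 * x - 1) * T ^ 3 = (2 * x - 1) * (T ^ 3 * T) := by ring
    _ ≤ (2 * x - 1) * ((x ^ 2 + T ^ 2) * ((1 - x) ^ 2 + T ^ 2)) :=
        mul_le_mul_of_nonneg_left h3 (by linarith)

/-- Stirling for `Im ψ(s/2)`, `s = x + iT`, `x > 0`, `T > 0`:
`Im ψ(s/2) = π/2 - arctan(x/T) + T/(x²+T²) + O(1/T²)`. [folklore] -/
theorem abs_im_digamma_half_sub_le {x T : ℝ} (hx : 0 < x) (hT : 0 < T) :
    |(Complex.digamma (((x : ℂ) + T * I) / 2)).im -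
        (π / 2 - Real.arctan (x / T) + T / (x ^ 2 + T ^ 2))| ≤
      4 / (3 * T ^ 3) + π / (3 * T ^ 2) := by
  set w : ℂ := ((x : ℂ) + T * I) / 2 with hw
  have hwre : w.re = x / 2 := by simp [hw]
  have hwim : w.im = T / 2 := by simp [hw]
  have hw0 : 0 < w.re := by rw [hwre]; positivity
  have hw1 : 0 < w.im := by rw [hwim]; positivity
  have h := Literature.Analysis.SpecialFunctions.Complex.abs_im_digamma_sub_arg_add_im_le hw0 hw1
  have harg : arg w = π / 2 - Real.arctan (x / T) := by
    rw [Literature.Analysis.SpecialFunctions.Complex.arg_eq_pi_div_two_sub_arctan hw0 hw1, hwre, hwim]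
    congr 2
    field_simp
  have hinv : (1 / (2 * w)).im = -T / (x ^ 2 + T ^ 2) := by
    have : 2 * w = (x : ℂ) + T * I := by rw [hw]; ring
    rw [this, one_div, im_inv_ofReal_add_mul_I]
  rw [harg, hinv, hwim, abs_of_pos (by positivity : (0 : ℝ) < T / 2)] at h
  have e1 : 1 / (6 * (T / 2) ^ 3) + π / (12 * (T / 2) ^ 2) = 4 / (3 * T ^ 3) + π / (3 * T ^ 2) := by
    field_simp
    ring
  rw [e1] at h
  convert h using 2
  ring


/-- `Im log π = 0`. [folklore] -/
theorem log_pi_im : (Complex.log (π : ℂ)).im = 0 := by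
  rw [Complex.log_im]; exact Complex.arg_ofReal_of_nonneg Real.pi_pos.le

/-- **The imaginary part of `ζ₁'/ζ₁` on a horizontal line**, `ζ₁(s) = (s-1)ζ(s)`, `s = x + iT`,
`x > 0`, `T > 0`, `ζ(s) ≠ 0`:
`Im ζ₁'/ζ₁(s) = Im ξ'/ξ(s) + T/(x²+T²) - ½ Im ψ(s/2)` (`ξ'/ξ = 1/s + Γℝ'/Γℝ + ζ₁'/ζ₁`,
`Γℝ'/Γℝ = -½ log π + ½ ψ(s/2)`). [cite: Titchmarsh1986, §2.12] -/
theorem im_logDeriv_riemannZeta₁_eq {x T : ℝ} (hx : 0 < x) (hT : 0 < T)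
    (hζ : riemannZeta ((x : ℂ) + T * I) ≠ 0) :
    (logDeriv riemannZeta₁ ((x : ℂ) + T * I)).im =
      (logDeriv riemannXi ((x : ℂ) + T * I)).im + T / (x ^ 2 + T ^ 2) -
        (Complex.digamma (((x : ℂ) + T * I) / 2)).im / 2 := by
  set s : ℂ := (x : ℂ) + T * I with hs
  have hsre : 0 < s.re := by simp [hs, hx]
  have hs1 : s ≠ 1 := fun h ↦ by
    have := congrArg Complex.im h; simp [hs] at this; exact hT.ne' this
  have hζ₁ : riemannZeta₁ s ≠ 0 := fun h ↦ hζ ((riemannZeta₁_eq_zero_iff hs1).1 h)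
  have h1 := logDeriv_riemannXi_eq hsre hζ₁
  have h2 := LFunctions.logDeriv_Gammaℝ (half_ne_neg_nat_of_re_pos' hsre)
  have e : logDeriv riemannZeta₁ s = logDeriv riemannXi s - 1 / s - logDeriv Gammaℝ s := by
    rw [h1]; ring
  rw [e, h2, Complex.sub_im, Complex.sub_im, Complex.add_im, one_div, hs, im_inv_ofReal_add_mul_I]
  have h3 : (-(Complex.log (π : ℂ)) / 2).im = 0 := by
    rw [Complex.div_ofNat_im, Complex.neg_im, log_pi_im]; simp
  rw [h3, Complex.div_ofNat_im]
  ring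

/-- **Reflection of `Im ζ₁'/ζ₁` in the critical line, pointwise.** For `½ ≤ x < 1`, `T > 0`, and
`ζ ≠ 0` at `x + iT` and `(1-x) + iT`:
`|Im ζ₁'/ζ₁(x+iT) - Im ζ₁'/ζ₁((1-x)+iT)| ≤ (2x-1)(1/(2T) + 1/(2T³)) + 4/(3T³) + π/(3T²)`.
The `ξ'/ξ` parts cancel exactly (`ξ'/ξ(1-s̄) = -conj ξ'/ξ(s)`, the functional equation); what is
left is the variation of `arg` of `s` and of `Γℝ(s)` across the critical line, i.e. the quantity
`𝓔(T,d)` (plus the arctangent terms) of [BMOR21, Def. 3.3] and [HasanalizadeShenWong2022, §2],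
here bounded by Stirling's formula for `Im ψ` instead of by `π/2 + E(T,d)`.
[cite: HasanalizadeShenWong2022, Lemma 2.1] -/
theorem abs_im_logDeriv_riemannZeta₁_sub_reflect_le {x T : ℝ} (hx : 1 / 2 ≤ x) (hx1 : x < 1)
    (hT : 0 < T) (hζ : riemannZeta ((x : ℂ) + T * I) ≠ 0)
    (hζ' : riemannZeta (((1 - x : ℝ) : ℂ) + T * I) ≠ 0) :
    |(logDeriv riemannZeta₁ ((x : ℂ) + T * I)).im -
        (logDeriv riemannZeta₁ (((1 - x : ℝ) : ℂ) + T * I)).im| ≤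
      (2 * x - 1) * (1 / (2 * T) + 1 / (2 * T ^ 3)) + (4 / (3 * T ^ 3) + π / (3 * T ^ 2)) := by
  have hx0 : 0 < x := by linarith
  have hx0' : 0 < 1 - x := by linarith
  rw [im_logDeriv_riemannZeta₁_eq hx0 hT hζ, im_logDeriv_riemannZeta₁_eq hx0' hT hζ']
  -- the `ξ` parts agree
  have hξ : (logDeriv riemannXi (((1 - x : ℝ) : ℂ) + T * I)).im =
      (logDeriv riemannXi ((x : ℂ) + T * I)).im := by
    have e : (((1 - x : ℝ) : ℂ) + T * I) = 1 - conj ((x : ℂ) + T * I) := by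
      apply Complex.ext <;> simp
    rw [e, logDeriv_riemannXi_one_sub, logDeriv_riemannXi_conj, Complex.neg_im, Complex.conj_im,
      neg_neg]
  rw [hξ]
  -- Stirling for the two digamma values
  have hψ1 := abs_im_digamma_half_sub_le hx0 hT
  have hψ2 := abs_im_digamma_half_sub_le hx0' hT
  -- the elementary differences
  have hK := abs_sub_kernel_le hx hT
  have hA : |Real.arctan ((1 - x) / T) - Real.arctan (x / T)| ≤ (2 * x - 1) / T := by
    have hL := lipschitzWith_one_arctan.dist_le_mul ((1 - x) / T) (x / T)
    simp only [Real.dist_eq, NNReal.coe_one, one_mul] at hL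
    refine hL.trans ?_
    rw [div_sub_div_same, abs_div, abs_of_pos hT]
    apply div_le_div_of_nonneg_right _ hT.le
    rw [abs_le]; constructor <;> linarith
  -- name the small quantities
  set K := T / (x ^ 2 + T ^ 2) - T / ((1 - x) ^ 2 + T ^ 2) with hKdef
  set D := Real.arctan ((1 - x) / T) - Real.arctan (x / T) with hDdef
  set e₁ := (Complex.digamma (((x : ℂ) + T * I) / 2)).im -
    (π / 2 - Real.arctan (x / T) + T / (x ^ 2 + T ^ 2)) with he₁
  set e₂ := (Complex.digamma ((((1 - x : ℝ) : ℂ) + T * I) / 2)).im -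
    (π / 2 - Real.arctan ((1 - x) / T) + T / ((1 - x) ^ 2 + T ^ 2)) with he₂
  have hE : (logDeriv riemannXi ((x : ℂ) + T * I)).im + T / (x ^ 2 + T ^ 2) -
        (Complex.digamma (((x : ℂ) + T * I) / 2)).im / 2 -
      ((logDeriv riemannXi ((x : ℂ) + T * I)).im + T / ((1 - x) ^ 2 + T ^ 2) -
        (Complex.digamma ((((1 - x : ℝ) : ℂ) + T * I) / 2)).im / 2) =
      K / 2 - D / 2 - (e₁ - e₂) / 2 := by
    simp only [hKdef, hDdef, he₁, he₂]; ring
  rw [hE]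
  have eR : (2 * x - 1) * (1 / (2 * T) + 1 / (2 * T ^ 3)) =
      ((2 * x - 1) / T ^ 3) / 2 + ((2 * x - 1) / T) / 2 := by ring
  rw [eR]
  rw [abs_le] at hψ1 hψ2 hK hA ⊢
  constructor <;> linarith [hψ1.1, hψ1.2, hψ2.1, hψ2.2, hK.1, hK.2, hA.1, hA.2]

/-- If no zero of `ζ` has ordinate `T > 0`, then `ζ₁ = (s-1)ζ(s)` has no zero on `Im s = T`.
[folklore] -/
theorem riemannZeta₁_ne_zero_of_im_eq {T : ℝ} (hT : 0 < T)
    (hT' : ∀ ρ : ℂ, riemannZeta ρ = 0 → ρ.im ≠ T) (x : ℝ) :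
    riemannZeta₁ ((x : ℂ) + T * I) ≠ 0 := by
  have hs1 : (x : ℂ) + T * I ≠ 1 := fun h ↦ by
    have := congrArg Complex.im h; simp at this; exact hT.ne' this
  exact fun h ↦ hT' _ ((riemannZeta₁_eq_zero_iff hs1).1 h) (by simp)

/-- `x ↦ ζ₁'/ζ₁(x + iT)` is continuous when `T > 0` is not an ordinate. [folklore] -/
theorem continuous_logDeriv_riemannZeta₁_horizontal {T : ℝ} (hT : 0 < T)
    (hT' : ∀ ρ : ℂ, riemannZeta ρ = 0 → ρ.im ≠ T) :
    Continuous fun x : ℝ ↦ deriv riemannZeta₁ ((x : ℂ) + T * I) / riemannZeta₁ ((x : ℂ) + T * I) := by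
  have hline : Continuous fun x : ℝ ↦ (x : ℂ) + T * I := by fun_prop
  have han : AnalyticOnNhd ℂ riemannZeta₁ univ :=
    differentiable_riemannZeta₁.differentiableOn.analyticOnNhd isOpen_univ
  have hd : Continuous (deriv riemannZeta₁) := continuousOn_univ.1 han.deriv.continuousOn
  exact (hd.comp hline).div (differentiable_riemannZeta₁.continuous.comp hline)
    fun x ↦ riemannZeta₁_ne_zero_of_im_eq hT hT' x

/-- **Reflection of the argument of `(s-1)ζ(s)` in the critical line** (the hypothesis `hrefl` of
Backlund's trick `Literature.Analysis.Complex.abs_im_integral_logDeriv_le_backlundTrick` for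
`g = ζ₁`, `x₀ = ½`): for `T ≥ 4` not the ordinate of a zero and `0 ≤ d ≤ 3/8`,
`|Im ∫_{1/2}^{1/2+d} ζ₁'/ζ₁(x+iT) dx + Im ∫_{1/2}^{1/2-d} ζ₁'/ζ₁(x+iT) dx| ≤ 1/T`.
(In [HasanalizadeShenWong2022, Prop. 3.2] / [BMOR21, Lemma 5.3] this quantity is bounded by
`E(T,δ) + π/2` for `T ≥ 5/7`; for large `T` Stirling's formula gives `O(d²/T)`.)
[cite: HasanalizadeShenWong2022, Prop. 3.2] -/
theorem abs_im_integral_logDeriv_riemannZeta₁_reflect_le {T d : ℝ} (hT : 4 ≤ T)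
    (hT' : ∀ ρ : ℂ, riemannZeta ρ = 0 → ρ.im ≠ T) (hd0 : 0 ≤ d) (hd : d ≤ 3 / 8) :
    |(∫ x in (1 / 2 : ℝ)..(1 / 2 + d),
        deriv riemannZeta₁ ((x : ℂ) + T * I) / riemannZeta₁ ((x : ℂ) + T * I)).im +
      (∫ x in (1 / 2 : ℝ)..(1 / 2 - d),
        deriv riemannZeta₁ ((x : ℂ) + T * I) / riemannZeta₁ ((x : ℂ) + T * I)).im| ≤ 1 / T := by
  have hT0 : 0 < T := by linarith
  set f : ℝ → ℂ := fun x ↦ deriv riemannZeta₁ ((x : ℂ) + T * I) / riemannZeta₁ ((x : ℂ) + T * I)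
    with hf
  have hfc : Continuous f := continuous_logDeriv_riemannZeta₁_horizontal hT0 hT'
  have hζT : ∀ x : ℝ, riemannZeta ((x : ℂ) + T * I) ≠ 0 := fun x h ↦ hT' _ h (by simp)
  -- fold the second integral onto `[1/2, 1/2 + d]`
  have hfc' : Continuous fun x : ℝ ↦ f (1 - x) := hfc.comp (by fun_prop)
  have hI2 : ∫ x in (1 / 2 : ℝ)..(1 / 2 - d), f x = -∫ x in (1 / 2 : ℝ)..(1 / 2 + d), f (1 - x) := by
    have h := intervalIntegral.integral_comp_sub_left (fun x ↦ f x) (1 : ℝ) (a := 1 / 2) (b := 1 / 2 + d)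
    rw [show (1 : ℝ) - (1 / 2 + d) = 1 / 2 - d by ring, show (1 : ℝ) - 1 / 2 = 1 / 2 by norm_num,
      intervalIntegral.integral_symm (1 / 2) (1 / 2 - d)] at h
    rw [h, neg_neg]
  have hint : IntervalIntegrable (fun x ↦ f x - f (1 - x)) volume (1 / 2) (1 / 2 + d) :=
    (hfc.sub hfc').intervalIntegrable _ _
  have hsum : (∫ x in (1 / 2 : ℝ)..(1 / 2 + d), f x).im +
      (∫ x in (1 / 2 : ℝ)..(1 / 2 - d), f x).im =
        ∫ x in (1 / 2 : ℝ)..(1 / 2 + d), ((f x).im - (f (1 - x)).im) := by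
    rw [hI2, Complex.neg_im, ← sub_eq_add_neg, ← Complex.sub_im,
      ← intervalIntegral.integral_sub (hfc.intervalIntegrable _ _) (hfc'.intervalIntegrable _ _)]
    have hcomm := ContinuousLinearMap.intervalIntegral_comp_comm (𝕜 := ℝ) imCLM hint
    simp only [imCLM_apply, Complex.sub_im] at hcomm
    rw [← hcomm]
  rw [hsum]
  -- pointwise bound on `[1/2, 1/2 + d]`
  set B : ℝ := 2 * d * (1 / (2 * T) + 1 / (2 * T ^ 3)) + (4 / (3 * T ^ 3) + π / (3 * T ^ 2)) with hB
  have hptw : ∀ x ∈ Set.uIoc (1 / 2 : ℝ) (1 / 2 + d), ‖(f x).im - (f (1 - x)).im‖ ≤ B := by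
    intro x hx
    rw [uIoc_of_le (by linarith)] at hx
    have hx1 : x < 1 := by linarith [hx.2]
    have h := abs_im_logDeriv_riemannZeta₁_sub_reflect_le hx.1.le hx1 hT0 (hζT x)
      (by exact_mod_cast hζT (1 - x))
    rw [Real.norm_eq_abs]
    have ef : ∀ u : ℝ, f u = logDeriv riemannZeta₁ ((u : ℂ) + T * I) := fun u ↦ rfl
    rw [ef, ef]
    push_cast at h ⊢
    refine h.trans ?_
    rw [hB]
    have h1 : 2 * x - 1 ≤ 2 * d := by linarith [hx.2]
    have h2 : 0 ≤ 1 / (2 * T) + 1 / (2 * T ^ 3) := by positivity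
    nlinarith
  have hI := intervalIntegral.norm_integral_le_of_norm_le_const hptw
  rw [Real.norm_eq_abs, show (1 / 2 + d - 1 / 2 : ℝ) = d by ring, abs_of_nonneg hd0] at hI
  refine hI.trans ?_
  -- `B d ≤ 1/T`
  rw [hB]
  have hπ := Real.pi_lt_d2
  have hu1 : 1 / T ≤ 1 / 4 := one_div_le_one_div_of_le (by norm_num) hT
  have hu0 : 0 < 1 / T := by positivity
  have e : (2 * d * (1 / (2 * T) + 1 / (2 * T ^ 3)) + (4 / (3 * T ^ 3) + π / (3 * T ^ 2))) * d =
      (1 / T) * (d * d * (1 + (1 / T) ^ 2) + d * (4 / 3 * (1 / T) ^ 2 + π / 3 * (1 / T))) := by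
    field_simp
  rw [e]
  have hpoly : d * d * (1 + (1 / T) ^ 2) + d * (4 / 3 * (1 / T) ^ 2 + π / 3 * (1 / T)) ≤ 1 := by
    set u := 1 / T with hu
    have hu2 : u ^ 2 ≤ 1 / 16 := by nlinarith
    nlinarith [mul_nonneg hd0 hu0.le, sq_nonneg d, mul_nonneg hd0 (sq_nonneg u),
      mul_nonneg (mul_nonneg hd0 hd0) (sq_nonneg u)]
  calc 1 / T * _ ≤ 1 / T * 1 := mul_le_mul_of_nonneg_left hpoly hu0.le
    _ = 1 / T := mul_one _

end ZetaBacklundReflection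

end Literature.NumberTheory.LFunctions
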